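import Mathlib
import Summits.ResolutionOfSingularities.ResolutionOfSingularities.Theorems.WeightedInvariantLocalWeightedDropTOT2StepCurve
/-!
# TOT2-LINE (P3) B6 step (DIM-PREMISE VARIANT of res-L1-w43-stub-2's file: `hB4` carries `ringKrullDim (R₃ ⧸ P′) = 1`, as the landed bricks B4-1..4 do — res-L1-w43-lead-1 g6)s 2–3/6: THE CURVE MOVES — an abstract «plane-fixing chart» does not raise the budget

Sub-problem `ResolutionOfSingularities`, ENGINE crux `stmt-ResolutionOfSingularities-8899` (`LocalWeightedDrop`), skeleton v35 (2e806da509994632),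
registered stub `stub_conflictBudget` (P3); plan `L/res-L1-w43-stub-2/g6/B6-PLAN.md` §1.  [OURS · L1 W4.3 · chain w43 · res-L1-w43-stub-2 g6 (owner of
(P3)); def-free; bricks B3 / B4-3,4 / D3 v2 / injectivity as typed HYPOTHESES; nothing here is a statement of any manuscript; AI-produced,
gate-checked, weaker than expert review.]

For the blow-ups of `V(y,u₁)` (`divOneT`, chart `(u₁,u₂,u₁y)`) and `V(y,u₂)` (`divTwoT`, chart `(u₁,u₂,u₂y)`) the chart `Φ` FIXES the plane
series, so every surviving branch keeps its values `v(u₁)`, `v(u₂)` and its pair terms do not increase; with an unchanged letter bit the charges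
are equal and `budget_le` gives `M′ ≤ M`.  Stated ONCE for an abstract plane-fixing `Φ` with exceptional variable `X e` and abstract labels
`A, A′` (`conflictBudgetD_le_of_planeFixing_of_dim`); the two curve moves are its instances once B3/B4 land.
-/

set_option linter.dupNamespace false -- mandated namespace of this single-conjunct summit

noncomputable section

namespace Summit.ResolutionOfSingularities.ResolutionOfSingularities.Theorems

namespace TOT2Branch

open MvPowerSeries IsLocalRing PolyDescent Literature.AlgebraicGeometry.Resolution

variable {k : Type} [Field k]

/-- **B6 STEPS 2–3: A PLANE-FIXING CHART DOES NOT RAISE THE BUDGET.**  `Φ` fixes `toThree g`, `X 0`, `X 1`; `X e` is its exceptional variable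
(`e = 0` for `divOneT`, `e = 1` for `divTwoT`); the letter bit of `(A′,N′)` equals that of `(A,N)`; bricks B3 / B4 / D3 / injectivity for `Φ`
and `e` as hypotheses; context for `(A,N)`.  Then `conflictBudgetD d A′ N′ ≤ conflictBudgetD d A N`. -/
theorem conflictBudgetD_le_of_planeFixing_of_dim (p : ℕ) [Fact p.Prime] [CharP k p] [IsAlgClosed k] {d : ℕ} {A A' : Fin d → MvPowerSeries (Fin 2) k}
    {N N' : Finset (Fin 2)} (Φ : MvPowerSeries (Fin 3) k →ₐ[k] MvPowerSeries (Fin 3) k) (e : Fin 2)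
    (hfix : ∀ g : MvPowerSeries (Fin 2) k, Φ (toThree g) = toThree g)
    (hB3 : ∀ (P' : Ideal (MvPowerSeries (Fin 3) k)) [P'.IsPrime], ringKrullDim (MvPowerSeries (Fin 3) k ⧸ P') = 1 →
      (X (Fin.castSucc e) : MvPowerSeries (Fin 3) k) ∉ P' →
      ringKrullDim (MvPowerSeries (Fin 3) k ⧸ P'.comap Φ) = 1 ∧ ∀ f, branchVal (P'.comap Φ) f = branchVal P' (Φ f))
    (hB4 : ∀ (P' : Ideal (MvPowerSeries (Fin 3) k)), P' ∈ topPrimes d A' → (X (Fin.castSucc e) : MvPowerSeries (Fin 3) k) ∉ P' →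
      ringKrullDim (MvPowerSeries (Fin 3) k ⧸ P') = 1 → P'.comap Φ ∈ topPrimes d A)
    (hD3 : ∀ (P Q : Ideal (MvPowerSeries (Fin 3) k)), P ∈ topPrimes d A → Q ∈ topPrimes d A → P ≠ Q →
      ringKrullDim (MvPowerSeries (Fin 3) k ⧸ P) = 1 → ringKrullDim (MvPowerSeries (Fin 3) k ⧸ Q) = 1 → pairVal P Q < ⊤)
    (hinj : ∀ (P' Q' : Ideal (MvPowerSeries (Fin 3) k)), P'.IsPrime → Q'.IsPrime → ringKrullDim (MvPowerSeries (Fin 3) k ⧸ P') = 1 →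
      ringKrullDim (MvPowerSeries (Fin 3) k ⧸ Q') = 1 → (X (Fin.castSucc e) : MvPowerSeries (Fin 3) k) ∉ P' →
      (X (Fin.castSucc e) : MvPowerSeries (Fin 3) k) ∉ Q' → P'.comap Φ = Q'.comap Φ → P' = Q')
    (hβ : betaTwo d A' N' = betaTwo d A N)
    (hctx : ∃ (b : MvPowerSeries (Fin (2 + 1)) k) (δ : TameFourTupleDrop.Decoration k 2) (Θ : Fin (2 + 1) → MvPowerSeries (Fin (2 + 1)) k),
      TameFourTupleDrop.Admissible b δ ∧ 2 ≤ δ.o ∧ δ.c = d ∧ δ.PresBy d A N Θ) :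
    conflictBudgetD d A' N' ≤ conflictBudgetD d A N := by
  classical
  have hΦX : ∀ i : Fin 2, Φ (X (Fin.castSucc i)) = X (Fin.castSucc i) := fun i => by rw [← toThree_X, hfix]
  have hΦX0 : Φ (X 0) = X 0 := hΦX 0
  have hΦX1 : Φ (X 1) = X 1 := hΦX 1
  have hXe : ∀ {P' : Ideal (MvPowerSeries (Fin 3) k)}, (X 0 : MvPowerSeries (Fin 3) k) ∉ P' → (X 1 : MvPowerSeries (Fin 3) k) ∉ P' →
      (X (Fin.castSucc e) : MvPowerSeries (Fin 3) k) ∉ P' := by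
    intro P' h0 h1; fin_cases e
    · exact h0
    · exact h1
  -- index sets
  have hfinS : (topPrimesDNL d A).Finite := (topPrimesNL_finite p hctx).subset (topPrimesDNL_subset_topPrimesNL d A)
  set ι : Ideal (MvPowerSeries (Fin 3) k) → Ideal (MvPowerSeries (Fin 3) k) := fun P' => P'.comap Φ with hιdef
  have hιmem : ∀ P' ∈ topPrimesDNL d A', ι P' ∈ topPrimesDNL d A := by
    intro P' hP'
    obtain ⟨⟨hP'top, hdim'⟩, hX0', hX1'⟩ := hP'
    haveI := hP'top.1
    obtain ⟨hdim, -⟩ := hB3 P' hdim' (hXe hX0' hX1')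
    refine ⟨⟨hB4 P' hP'top (hXe hX0' hX1') hdim', hdim⟩, ?_, ?_⟩
    · rw [hιdef, Ideal.mem_comap]; show Φ (X 0) ∉ P'; rw [hΦX0]; exact hX0'
    · rw [hιdef, Ideal.mem_comap]; show Φ (X 1) ∉ P'; rw [hΦX1]; exact hX1'
  have hinjOn : Set.InjOn ι (topPrimesDNL d A') := by
    intro P' hP' Q' hQ' h
    exact hinj P' Q' hP'.1.1.1 hQ'.1.1.1 hP'.1.2 hQ'.1.2 (hXe hP'.2.1 hP'.2.2) (hXe hQ'.2.1 hQ'.2.2) h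
  have hfinS' : (topPrimesDNL d A').Finite :=
    Set.Finite.of_finite_image (hfinS.subset (fun P hP => by obtain ⟨P', hP', rfl⟩ := hP; exact hιmem P' hP')) hinjOn
  set S := hfinS.toFinset with hSdef
  set S' := hfinS'.toFinset with hS'def
  have hmemS : ∀ {P}, P ∈ S ↔ P ∈ topPrimesDNL d A := fun {P} => Set.Finite.mem_toFinset _
  have hmemS' : ∀ {P'}, P' ∈ S' ↔ P' ∈ topPrimesDNL d A' := fun {P'} => Set.Finite.mem_toFinset _
  -- charges are equal
  have hc : ∀ P' ∈ S', charge d A' N' P' ≤ charge d A N (ι P') +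
      2 * ∑ Q ∈ S.filter (fun Q => Q ∉ S'.image ι), ((pairVal (ι P') Q).toNat + (pairVal Q (ι P')).toNat) := by
    intro P' hP'
    obtain ⟨⟨hP'top, hdim'⟩, hX0', hX1'⟩ := hmemS'.mp hP'
    haveI := hP'top.1
    obtain ⟨-, hval⟩ := hB3 P' hdim' (hXe hX0' hX1')
    have h0 : branchVal P' (X 0) = branchVal (ι P') (X 0) := by rw [hιdef]; show _ = branchVal (P'.comap Φ) (X 0); rw [hval, hΦX0]
    have h1 : branchVal P' (X 1) = branchVal (ι P') (X 1) := by rw [hιdef]; show _ = branchVal (P'.comap Φ) (X 1); rw [hval, hΦX1]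
    exact le_add_right (charge_eq_of_vals hβ h0 h1).le
  -- pairs do not increase (`u = 1`)
  have hq : ∀ P' ∈ S', ∀ Q' ∈ S', P' ≠ Q' → (pairVal P' Q').toNat ≤ (pairVal (ι P') (ι Q')).toNat := by
    intro P' hP' Q' hQ' hne
    have hP'm := hmemS'.mp hP'
    have hQ'm := hmemS'.mp hQ'
    haveI := hP'm.1.1.1
    haveI := hQ'm.1.1.1
    obtain ⟨-, hval⟩ := hB3 P' hP'm.1.2 (hXe hP'm.2.1 hP'm.2.2)
    have hle : pairVal P' Q' + branchVal P' 1 ≤ pairVal (ι P') (ι Q') :=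
      pairVal_add_le_of_transport Φ.toRingHom (fun g => g) hfix hP'm.1.2 rfl rfl (fun f => (hval f).symm ▸ rfl) 1
        (fun h => hQ'm.1.1.1.ne_top ((Ideal.eq_top_iff_one _).mpr h)) fun g _ => ⟨g, by rw [one_mul]⟩
    have hιne : ι P' ≠ ι Q' := fun h => hne (hinjOn hP'm hQ'm h)
    have hfin : pairVal (ι P') (ι Q') < ⊤ :=
      hD3 _ _ (hιmem P' hP'm).1.1 (hιmem Q' hQ'm).1.1 hιne (hιmem P' hP'm).1.2 (hιmem Q' hQ'm).1.2
    exact ENat.toNat_le_toNat (le_trans le_self_add hle) hfin.ne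
  have hιS : ∀ P' ∈ S', ι P' ∈ S := fun P' hP' => hmemS.mpr (hιmem P' (hmemS'.mp hP'))
  have hinjS : Set.InjOn ι S' := fun P' hP' Q' hQ' h => hinjOn (hmemS'.mp hP') (hmemS'.mp hQ') h
  have hmain := budget_le S' S ι hιS hinjS (charge d A' N') (charge d A N) (fun P' Q' => (pairVal P' Q').toNat)
    (fun P Q => (pairVal P Q).toNat) hq hc
  rw [conflictBudgetD_eq_sum hfinS' N', conflictBudgetD_eq_sum hfinS N, ← hSdef, ← hS'def]
  exact hmain

end TOT2Branch

end Summit.ResolutionOfSingularities.ResolutionOfSingularities.Theorems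

end
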